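import Literature.Barriers.RiemannHypothesis.FeketePolyaPositivityEven
import HarnessLib

/-!
# Fekete–Pólya positivity from a finite value table: `L(σ, χ) > 0` on `σ > 0` by a kernel
# computation over one period (orders one and two)

Topic `Literature/NumberTheory/LFunctions`; namespace `Literature.NumberTheory.LFunctions.FeketePolyaTable`.
Small computable definitions (`tableVal`, `psum`, `psum2`: a periodic value table and its first and
second running sums, over `ℤ`) and THEOREMS — no named fact, no `sorry`. A reusable engine for the
kernel files that certify "no real zero" for individual real Dirichlet characters of small modulus.

The tree proves Fekete–Pólya's criterion for Mathlib's analytically continued `L(s, χ)`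
(`Literature.Barriers.RiemannHypothesis.LFunction_re_pos_of_summatory_nonneg`: `χ ≠ χ₀` and
`S_1(N) = ∑_{n ≤ N} ℜχ(n) ≥ 0` for all `N` give `ℜL(σ, χ) > 0` for `σ > 0`; Montgomery–Vaughan §11.2.1
Exercise 7 (a)) and its order-two form (`LFunction_re_pos_of_iterSummatory_two_nonneg`:
`S_2(N) = ∑_{n ≤ N} S_1(n) ≥ 0` suffices; Exercise 7 (f)–(g), needed for EVEN characters, whose `S_1`
always dips to `−1`). For a character of modulus `q` the hypotheses are `q`-periodic statements once
`S_1(q) = 0` (and `S_2(q) = 0`), so they reduce to FINITELY many integer inequalities, decidable by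
`decide` on a value table. This file packages exactly that:

* `tableVal l n = l[n mod |l|]` (a periodic integer table), `psum l N = ∑_{n ≤ N} tableVal l n`,
  `psum2 l N = ∑_{n ≤ N} psum l n`;
* periodicity `psum_add_length`, `psum2_add_length` and the reductions `psum_nonneg_of_check`,
  `psum2_nonneg_of_check` (one period checked ⇒ all `N`);
* the bridges `summatory_re_eq_psum`, `iterSummatory_two_re_eq_psum2` to the tree's `summatory` /
  `iterSummatory` of `n ↦ ℜχ(n)` when `χ(n) = tableVal l n`;
* **the engines** `lfunction_re_pos_of_table_one` / `lfunction_re_pos_of_table_two`: for `χ ≠ χ₀` mod `q`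
  with `χ(n) = tableVal l n` for all `n`, `psum l |l| = 0` (resp. also `psum2 l |l| = 0`) and the finite
  check `psum l N ≥ 0` (resp. `psum2 l N ≥ 0`) for `N ≤ |l|`: `ℜL(σ, χ) > 0` for every `σ > 0`, hence
  `L(σ, χ) ≠ 0` (`lfunction_ne_zero_of_table_one/two`).

## References

* H. L. Montgomery, R. C. Vaughan, *Multiplicative Number Theory I*, CUP 2007, §11.2.1 Exercise 7
  (a), (f), (g). [MontgomeryVaughan2007]
* M. Fekete, G. Pólya, *Über ein Problem von Laguerre*, Rend. Circ. Mat. Palermo 34 (1912) 89–120.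
  [FeketePolya1912]
-/

namespace Literature.NumberTheory.LFunctions

namespace FeketePolyaTable

open Literature.Barriers.RiemannHypothesis

/-! ### Periodic integer tables and their running sums -/

/-- A periodic value table: `tableVal l n = l[n mod |l|]` (default `0` for the empty list).
[cite: MontgomeryVaughan2007, §11.2.1 Exercise 7] -/
def tableVal (l : List ℤ) (n : ℕ) : ℤ := l.getD (n % l.length) 0

/-- First running sum `S_1(N) = ∑_{n=1}^{N} tableVal l n`. [cite: MontgomeryVaughan2007, §11.2.1 Exercise 7] -/
def psum (l : List ℤ) : ℕ → ℤ
  | 0 => 0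
  | N + 1 => psum l N + tableVal l (N + 1)

/-- Second running sum `S_2(N) = ∑_{n=1}^{N} S_1(n)`. [cite: MontgomeryVaughan2007, §11.2.1 Exercise 7 (c)] -/
def psum2 (l : List ℤ) : ℕ → ℤ
  | 0 => 0
  | N + 1 => psum2 l N + psum l (N + 1)

variable (l : List ℤ)

/-- The table is `|l|`-periodic. [folklore] -/
private theorem tableVal_add_length (n : ℕ) : tableVal l (n + l.length) = tableVal l n := by
  simp [tableVal]

/-- The table only depends on `n mod |l|`. [folklore] -/
private theorem tableVal_mod (n : ℕ) : tableVal l (n % l.length) = tableVal l n := by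
  simp [tableVal]

/-- `S_1` is periodic once `S_1(|l|) = 0`. [folklore] -/
private theorem psum_add_length (h0 : psum l l.length = 0) (N : ℕ) :
    psum l (N + l.length) = psum l N := by
  induction N with
  | zero => simpa [psum] using h0
  | succ N ih =>
    rw [show N + 1 + l.length = (N + l.length) + 1 by omega, psum, psum, ih,
      show N + l.length + 1 = (N + 1) + l.length by omega, tableVal_add_length]

/-- Iterated periodicity of `S_1`. [folklore] -/
private theorem psum_add_mul_length (h0 : psum l l.length = 0) (k N : ℕ) :
    psum l (N + k * l.length) = psum l N := by
  induction k with
  | zero => simp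
  | succ k ih => rw [show N + (k + 1) * l.length = (N + k * l.length) + l.length by ring,
      psum_add_length l h0, ih]

/-- **One period suffices, order one**: if `S_1(|l|) = 0` and `S_1(N) ≥ 0` for `N ≤ |l|` (`|l| > 0`),
then `S_1(N) ≥ 0` for every `N`. [cite: MontgomeryVaughan2007, §11.2.1 Exercise 7 (a)] -/
theorem psum_nonneg_of_check (hl : 0 < l.length) (h0 : psum l l.length = 0)
    (hchk : ∀ N, N ≤ l.length → 0 ≤ psum l N) (N : ℕ) : 0 ≤ psum l N := by
  have hN : N = N % l.length + (N / l.length) * l.length := by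
    rw [mul_comm]; exact (Nat.mod_add_div N l.length).symm
  rw [hN, psum_add_mul_length l h0]
  exact hchk _ (Nat.mod_lt N hl).le

/-- `S_2` is periodic once `S_1(|l|) = 0` and `S_2(|l|) = 0`. [folklore] -/
private theorem psum2_add_length (h0 : psum l l.length = 0) (h2 : psum2 l l.length = 0) (N : ℕ) :
    psum2 l (N + l.length) = psum2 l N := by
  induction N with
  | zero => simpa [psum2] using h2
  | succ N ih =>
    rw [show N + 1 + l.length = (N + l.length) + 1 by omega, psum2, psum2, ih,
      show N + l.length + 1 = (N + 1) + l.length by omega, psum_add_length l h0]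

/-- Iterated periodicity of `S_2`. [folklore] -/
private theorem psum2_add_mul_length (h0 : psum l l.length = 0) (h2 : psum2 l l.length = 0)
    (k N : ℕ) : psum2 l (N + k * l.length) = psum2 l N := by
  induction k with
  | zero => simp
  | succ k ih => rw [show N + (k + 1) * l.length = (N + k * l.length) + l.length by ring,
      psum2_add_length l h0 h2, ih]

/-- **One period suffices, order two**: if `S_1(|l|) = 0`, `S_2(|l|) = 0` and `S_2(N) ≥ 0` for
`N ≤ |l|` (`|l| > 0`), then `S_2(N) ≥ 0` for every `N`. [cite: MontgomeryVaughan2007, §11.2.1 Exercise 7 (f)] -/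
theorem psum2_nonneg_of_check (hl : 0 < l.length) (h0 : psum l l.length = 0)
    (h2 : psum2 l l.length = 0) (hchk : ∀ N, N ≤ l.length → 0 ≤ psum2 l N) (N : ℕ) :
    0 ≤ psum2 l N := by
  have hN : N = N % l.length + (N / l.length) * l.length := by
    rw [mul_comm]; exact (Nat.mod_add_div N l.length).symm
  rw [hN, psum2_add_mul_length l h0 h2]
  exact hchk _ (Nat.mod_lt N hl).le

/-! ### From a character with tabulated values to the tree's summatory functions -/

variable {q : ℕ} (χ : DirichletCharacter ℂ q)

/-- If `χ(n) = tableVal l n` for all `n`, then `S_1(N, ℜχ) = psum l N`.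
[cite: MontgomeryVaughan2007, §11.2.1 Exercise 7] -/
theorem summatory_re_eq_psum (hv : ∀ n : ℕ, χ (n : ZMod q) = ((tableVal l n : ℤ) : ℂ)) (N : ℕ) :
    summatory (fun n ↦ (χ (n : ZMod q)).re) N = (psum l N : ℝ) := by
  induction N with
  | zero => simp [psum]
  | succ N ih =>
    rw [summatory_succ, ih, hv, Complex.intCast_re, psum]
    push_cast
    ring

/-- If `χ(n) = tableVal l n` for all `n`, then `S_2(N, ℜχ) = psum2 l N`.
[cite: MontgomeryVaughan2007, §11.2.1 Exercise 7 (c)] -/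
theorem iterSummatory_two_re_eq_psum2 (hv : ∀ n : ℕ, χ (n : ZMod q) = ((tableVal l n : ℤ) : ℂ))
    (N : ℕ) : iterSummatory (fun n ↦ (χ (n : ZMod q)).re) 2 N = (psum2 l N : ℝ) := by
  rw [iterSummatory_succ, iterSummatory_succ, iterSummatory_zero]
  induction N with
  | zero => simp [psum2]
  | succ N ih =>
    rw [summatory_succ, ih, summatory_re_eq_psum l χ hv, psum2]
    push_cast
    ring

/-! ### The engines -/

/-- **Order one from a table.** Let `χ ≠ χ₀` be a Dirichlet character mod `q` with `χ(n) = tableVal l n`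
for all `n` (`|l| > 0`), `psum l |l| = 0`, and `psum l N ≥ 0` for all `N ≤ |l|` (a finite check). Then
`ℜL(σ, χ) > 0` for every `σ > 0` (Fekete–Pólya, MV Exercise 7 (a), through the tree's
`LFunction_re_pos_of_summatory_nonneg`). [cite: MontgomeryVaughan2007, §11.2.1 Exercise 7 (a)]
[cite: FeketePolya1912] -/
theorem lfunction_re_pos_of_table_one [NeZero q] (hχ : χ ≠ 1) (hl : 0 < l.length)
    (hv : ∀ n : ℕ, χ (n : ZMod q) = ((tableVal l n : ℤ) : ℂ)) (h0 : psum l l.length = 0)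
    (hchk : ∀ N, N ≤ l.length → 0 ≤ psum l N) {σ : ℝ} (hσ : 0 < σ) :
    0 < (χ.LFunction (σ : ℂ)).re := by
  refine LFunction_re_pos_of_summatory_nonneg χ hχ (fun N _ ↦ ?_) hσ
  rw [summatory_re_eq_psum l χ hv]
  exact_mod_cast psum_nonneg_of_check l hl h0 hchk N

/-- **Order two from a table.** Let `χ ≠ χ₀` mod `q` with `χ(n) = tableVal l n` for all `n` (`|l| > 0`),
`psum l |l| = 0`, `psum2 l |l| = 0`, and `psum2 l N ≥ 0` for all `N ≤ |l|`. Then `ℜL(σ, χ) > 0` for every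
`σ > 0` (MV Exercise 7 (f)–(g) at `k = 2`, through the tree's `LFunction_re_pos_of_iterSummatory_two_nonneg`).
[cite: MontgomeryVaughan2007, §11.2.1 Exercise 7 (f), (g)] [cite: FeketePolya1912] -/
theorem lfunction_re_pos_of_table_two [NeZero q] (hχ : χ ≠ 1) (hl : 0 < l.length)
    (hv : ∀ n : ℕ, χ (n : ZMod q) = ((tableVal l n : ℤ) : ℂ)) (h0 : psum l l.length = 0)
    (h2 : psum2 l l.length = 0) (hchk : ∀ N, N ≤ l.length → 0 ≤ psum2 l N) {σ : ℝ} (hσ : 0 < σ) :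
    0 < (χ.LFunction (σ : ℂ)).re := by
  refine LFunction_re_pos_of_iterSummatory_two_nonneg χ hχ (fun N _ ↦ ?_) hσ
  rw [iterSummatory_two_re_eq_psum2 l χ hv]
  exact_mod_cast psum2_nonneg_of_check l hl h0 h2 hchk N

/-- Order one, non-vanishing form: `L(σ, χ) ≠ 0` for `σ > 0`. [cite: MontgomeryVaughan2007, §11.2.1 Exercise 7 (a)] -/
theorem lfunction_ne_zero_of_table_one [NeZero q] (hχ : χ ≠ 1) (hl : 0 < l.length)
    (hv : ∀ n : ℕ, χ (n : ZMod q) = ((tableVal l n : ℤ) : ℂ)) (h0 : psum l l.length = 0)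
    (hchk : ∀ N, N ≤ l.length → 0 ≤ psum l N) {σ : ℝ} (hσ : 0 < σ) : χ.LFunction (σ : ℂ) ≠ 0 := by
  intro h
  have := lfunction_re_pos_of_table_one l χ hχ hl hv h0 hchk hσ
  rw [h, Complex.zero_re] at this
  exact lt_irrefl _ this

/-- Order two, non-vanishing form: `L(σ, χ) ≠ 0` for `σ > 0`. [cite: MontgomeryVaughan2007, §11.2.1 Exercise 7 (f), (g)] -/
theorem lfunction_ne_zero_of_table_two [NeZero q] (hχ : χ ≠ 1) (hl : 0 < l.length)
    (hv : ∀ n : ℕ, χ (n : ZMod q) = ((tableVal l n : ℤ) : ℂ)) (h0 : psum l l.length = 0)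
    (h2 : psum2 l l.length = 0) (hchk : ∀ N, N ≤ l.length → 0 ≤ psum2 l N) {σ : ℝ} (hσ : 0 < σ) :
    χ.LFunction (σ : ℂ) ≠ 0 := by
  intro h
  have := lfunction_re_pos_of_table_two l χ hχ hl hv h0 h2 hchk hσ
  rw [h, Complex.zero_re] at this
  exact lt_irrefl _ this

end FeketePolyaTable

end Literature.NumberTheory.LFunctions
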